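import Mathlib
import Literature.Analysis.FluidPDE.PineauVicolRDSSTuning
import HarnessLib

/-!
# Route CorkscrewDynamo · crux `CorkscrewProfile` (stmt-NavierStokesRegularity-11282) — tuned exponents for
# ARBITRARY rotation angles (lead c4, line `registered`, tool stub F3)

Registered tool stub `stub_angleTuning` of the near-identity rigidity theorem; pure real analysis and
Diophantine approximation, no PDE. A field which is rotated `c_n`-DSS about `e₃` through the angle `θ_n` is also
rotated `c_n^K`-DSS through `K θ_n` for every `K : ℕ`, and the angle only matters modulo `2π`. When `1 < c_n → 1`
and the angles `θ_n` are ARBITRARY, along a subsequence `φ` the exponents can be TUNED so that every scale `μ ≥ 1`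
is the limit of powers `c_{φ n}^{K_n}` whose accumulated angles `K_n θ_{φ n}` tend to `β log μ` modulo `2π`, for ONE
rate `β` (possibly `0`); the compactness step then produces a rotated SELF-similar limit with rate `β`.

* `exists_denominators`, `exists_retune_angles` — Dirichlet's approximation theorem
  (`Real.exists_int_int_abs_mul_sub_le`) with denominators `N_n = ⌊1/√(log c_n)⌋ + 1` (so `N_n log c_n → 0` and
  `1/(N_n + 1) → 0`) replaces `(c_n, θ_n)` by `(c_n^{m_n}, m_n θ_n − 2π j_n)`, `1 ≤ m_n ≤ N_n`, with
  `c_n^{m_n} → 1` and `m_n θ_n − 2π j_n → 0`.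
* `exists_rate_tuning` — for SMALL angles `θ_n → 0` the rates `r_n = θ_n / log c_n` either satisfy `|r_n| ≤ R`
  frequently for some `R` (Bolzano–Weierstrass: `r_{φ n} → β`, and the exponents `⌊log μ / log c_{φ n}⌋` of
  `PineauVicol2026.tendsto_pow_natFloor_log` need no correction), or `|r_n| → ∞` and
  `PineauVicol2026.exists_tuned_exponents` with speeds `r_n / 2` kills the rotation (`φ = id`, `β = 0`).
* `stub_angleTuning` — the registered signature, back in the original variables: `K_n = m_{φ n} k_n`,
  `M_n = j_{φ n} k_n + m'_n`.
-/

noncomputable section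

open Filter Set
open scoped Topology

namespace Summit.NavierStokesRegularity.NavierStokesRegularity.Theorems.CorkscrewProfile.Birth

set_option linter.dupNamespace false

open Literature.Analysis.FluidPDE

/-! ### Step A: Dirichlet re-tuning of arbitrary angles to small angles -/

/-- **Denominators for Dirichlet's theorem.** If `0 < L_n → 0` there are naturals `0 < N_n` with `N_n L_n → 0`
and `1 / (N_n + 1) → 0`: take `N_n = ⌊1/√L_n⌋ + 1`, so that `N_n L_n ≤ √L_n + L_n` and `1/(N_n + 1) ≤ √L_n`. -/
theorem exists_denominators {L : ℕ → ℝ} (hL : ∀ n, 0 < L n) (hlim : Tendsto L atTop (𝓝 0)) :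
    ∃ N : ℕ → ℕ, (∀ n, 0 < N n) ∧ Tendsto (fun n => (N n : ℝ) * L n) atTop (𝓝 0) ∧
      Tendsto (fun n => 1 / ((N n : ℝ) + 1)) atTop (𝓝 0) := by
  have hsqrt : Tendsto (fun n => Real.sqrt (L n)) atTop (𝓝 0) := by
    have h := (Real.continuous_sqrt.tendsto 0).comp hlim
    rwa [Function.comp_def, Real.sqrt_zero] at h
  have hsqrt0 : ∀ n, 0 < Real.sqrt (L n) := fun n => Real.sqrt_pos.2 (hL n)
  have hfl : ∀ n, (⌊1 / Real.sqrt (L n)⌋₊ : ℝ) ≤ 1 / Real.sqrt (L n) := fun n =>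
    Nat.floor_le (div_nonneg zero_le_one (hsqrt0 n).le)
  have hfl' : ∀ n, 1 / Real.sqrt (L n) < (⌊1 / Real.sqrt (L n)⌋₊ : ℝ) + 1 := fun n =>
    Nat.lt_floor_add_one _
  refine ⟨fun n => ⌊1 / Real.sqrt (L n)⌋₊ + 1, fun n => Nat.succ_pos _, ?_, ?_⟩
  · -- `0 ≤ N_n L_n ≤ √L_n + L_n → 0`
    have hup : ∀ n, ((⌊1 / Real.sqrt (L n)⌋₊ + 1 : ℕ) : ℝ) * L n ≤ Real.sqrt (L n) + L n := fun n => by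
      have h1 := mul_le_mul_of_nonneg_right (hfl n) (hL n).le
      rw [one_div_mul_eq_div, Real.div_sqrt] at h1
      push_cast
      linarith
    have hlow : ∀ n, 0 ≤ ((⌊1 / Real.sqrt (L n)⌋₊ + 1 : ℕ) : ℝ) * L n := fun n =>
      mul_nonneg (Nat.cast_nonneg _) (hL n).le
    have h := hsqrt.add hlim
    rw [add_zero] at h
    exact tendsto_of_tendsto_of_tendsto_of_le_of_le tendsto_const_nhds h hlow hup
  · -- `0 ≤ 1/(N_n + 1) ≤ √L_n → 0`
    have hup : ∀ n, 1 / (((⌊1 / Real.sqrt (L n)⌋₊ + 1 : ℕ) : ℝ) + 1) ≤ Real.sqrt (L n) := fun n => by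
      have hpos : (0 : ℝ) < ((⌊1 / Real.sqrt (L n)⌋₊ + 1 : ℕ) : ℝ) + 1 := by positivity
      have h1 := hfl' n
      rw [div_lt_iff₀ (hsqrt0 n)] at h1
      rw [div_le_iff₀ hpos]
      push_cast
      nlinarith [hsqrt0 n]
    have hlow : ∀ n, 0 ≤ 1 / (((⌊1 / Real.sqrt (L n)⌋₊ + 1 : ℕ) : ℝ) + 1) := fun n => by positivity
    exact tendsto_of_tendsto_of_tendsto_of_le_of_le tendsto_const_nhds hsqrt hlow hup

/-- **Dirichlet re-tuning of the angles.** If `1 < c_n → 1` and `θ_n` are ANY angles, there are multipliers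
`1 ≤ m_n` and integers `j_n` with `c_n^{m_n} → 1` and `m_n θ_n − 2π j_n → 0`: Dirichlet's approximation theorem
`Real.exists_int_int_abs_mul_sub_le` for `θ_n / 2π` with the denominators `N_n` of `exists_denominators`
(`L_n = log c_n`) gives `1 ≤ m_n ≤ N_n` and `|m_n θ_n − 2π j_n| ≤ 2π/(N_n + 1)`, while
`0 ≤ log c_n^{m_n} ≤ N_n log c_n → 0`. -/
theorem exists_retune_angles {c : ℕ → ℝ} (hc : ∀ n, 1 < c n) (hlim : Tendsto c atTop (𝓝 1)) (θ : ℕ → ℝ) :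
    ∃ (m : ℕ → ℕ) (j : ℕ → ℤ), (∀ n, 1 ≤ m n) ∧ Tendsto (fun n => c n ^ m n) atTop (𝓝 1) ∧
      Tendsto (fun n => (m n : ℝ) * θ n - 2 * Real.pi * (j n : ℝ)) atTop (𝓝 0) := by
  have hc0 : ∀ n, 0 < c n := fun n => zero_lt_one.trans (hc n)
  have hlog0 : ∀ n, 0 < Real.log (c n) := fun n => Real.log_pos (hc n)
  have hloglim : Tendsto (fun n => Real.log (c n)) atTop (𝓝 0) := by
    have h := (Real.continuousAt_log one_ne_zero).tendsto.comp hlim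
    rwa [Function.comp_def, Real.log_one] at h
  obtain ⟨N, hN0, hNL, hN1⟩ := exists_denominators hlog0 hloglim
  have h2π : 0 < 2 * Real.pi := by positivity
  -- Dirichlet's approximation theorem for each `n`
  have hD : ∀ n, ∃ (m : ℕ) (j : ℤ), 1 ≤ m ∧ m ≤ N n ∧
      |(m : ℝ) * θ n - 2 * Real.pi * j| ≤ 2 * Real.pi * (1 / ((N n : ℝ) + 1)) := by
    intro n
    obtain ⟨j, k, hk0, hkN, hjk⟩ := Real.exists_int_int_abs_mul_sub_le (θ n / (2 * Real.pi)) (hN0 n)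
    refine ⟨k.toNat, j, ?_, Int.toNat_le.2 hkN, ?_⟩
    · exact Int.lt_toNat.2 (by exact_mod_cast hk0)
    · have hk : ((k.toNat : ℕ) : ℝ) = (k : ℝ) := by
        have h : (k.toNat : ℤ) = k := Int.toNat_of_nonneg hk0.le
        exact_mod_cast h
      have e : (k : ℝ) * θ n - 2 * Real.pi * j = 2 * Real.pi * (k * (θ n / (2 * Real.pi)) - j) := by
        field_simp
      rw [hk, e, abs_mul, abs_of_pos h2π]
      exact mul_le_mul_of_nonneg_left hjk h2π.le
  choose m j hm1 hmN hmj using hD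
  refine ⟨m, j, hm1, ?_, ?_⟩
  · -- `0 ≤ m_n log c_n ≤ N_n log c_n → 0`, then exponentiate
    have hup : ∀ n, (m n : ℝ) * Real.log (c n) ≤ (N n : ℝ) * Real.log (c n) := fun n =>
      mul_le_mul_of_nonneg_right (Nat.cast_le.2 (hmN n)) (hlog0 n).le
    have hlow : ∀ n, 0 ≤ (m n : ℝ) * Real.log (c n) := fun n =>
      mul_nonneg (Nat.cast_nonneg _) (hlog0 n).le
    have hml : Tendsto (fun n => (m n : ℝ) * Real.log (c n)) atTop (𝓝 0) :=
      tendsto_of_tendsto_of_tendsto_of_le_of_le tendsto_const_nhds hNL hlow hup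
    have hexp := (Real.continuous_exp.tendsto _).comp hml
    rw [Real.exp_zero] at hexp
    refine hexp.congr fun n => ?_
    rw [Function.comp_apply, ← Real.log_pow, Real.exp_log (pow_pos (hc0 n) _)]
  · -- `|m_n θ_n − 2π j_n| ≤ 2π/(N_n + 1) → 0`
    have h := hN1.const_mul (2 * Real.pi)
    rw [mul_zero] at h
    refine squeeze_zero_norm (fun n => ?_) h
    rw [Real.norm_eq_abs]
    exact hmj n

/-! ### Steps B and C: the rate dichotomy for small angles -/

/-- **Rate dichotomy and tuning for small angles.** If `1 < c_n → 1` and `θ_n → 0`, then along a subsequence `φ`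
there is a rate `β` such that for every `μ ≥ 1` some powers `c_{φ n}^{k_n} → μ` have accumulated angles
`k_n θ_{φ n} → β log μ` modulo `2π`. With the rates `r_n = θ_n / log c_n`: if `|r_n| ≤ R` frequently,
Bolzano–Weierstrass (`tendsto_subseq_of_frequently_bounded`) gives `r_{φ n} → β`, and `k_n = ⌊log μ / log c_{φ n}⌋`
(`PineauVicol2026.tendsto_pow_natFloor_log`) has `k_n log c_{φ n} → log μ`, hence `k_n θ_{φ n} → β log μ` with no
correction; otherwise `|r_n| → ∞` and `PineauVicol2026.exists_tuned_exponents` with speeds `α_n = r_n / 2`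
(`|α_n| → ∞`, `α_n log c_n = θ_n / 2 → 0`) tunes the angles to `0 = 0 · log μ` (`φ = id`, `β = 0`). -/
theorem exists_rate_tuning {c θ : ℕ → ℝ} (hc : ∀ n, 1 < c n) (hlim : Tendsto c atTop (𝓝 1))
    (hθ : Tendsto θ atTop (𝓝 0)) :
    ∃ (φ : ℕ → ℕ) (β : ℝ), StrictMono φ ∧ ∀ μ : ℝ, 1 ≤ μ →
      ∃ (k : ℕ → ℕ) (m : ℕ → ℤ), Tendsto (fun n => c (φ n) ^ k n) atTop (𝓝 μ) ∧
        Tendsto (fun n => (k n : ℝ) * θ (φ n) - 2 * Real.pi * (m n : ℝ)) atTop (𝓝 (β * Real.log μ)) := by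
  have hlog0 : ∀ n, 0 < Real.log (c n) := fun n => Real.log_pos (hc n)
  -- the rates `r_n = θ_n / log c_n`
  set r : ℕ → ℝ := fun n => θ n / Real.log (c n) with hr
  have hrθ : ∀ n, r n * Real.log (c n) = θ n := fun n => div_mul_cancel₀ _ (hlog0 n).ne'
  by_cases hb : ∃ R, ∃ᶠ n in atTop, |r n| ≤ R
  · -- (B1) rates bounded frequently: Bolzano–Weierstrass
    obtain ⟨R, hR⟩ := hb
    have hR' : ∃ᶠ n in atTop, r n ∈ Icc (-R) R := hR.mono fun n hn => abs_le.1 hn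
    obtain ⟨β, -, φ, hφ, hβ⟩ := tendsto_subseq_of_frequently_bounded (Metric.isBounded_Icc (-R) R) hR'
    refine ⟨φ, β, hφ, fun μ hμ => ?_⟩
    have hμ0 : 0 < μ := one_pos.trans_le hμ
    have hcφ : ∀ n, 1 < c (φ n) := fun n => hc (φ n)
    have hlimφ : Tendsto (fun n => c (φ n)) atTop (𝓝 1) := hlim.comp hφ.tendsto_atTop
    have hk := PineauVicol2026.tendsto_pow_natFloor_log hcφ hlimφ hμ
    refine ⟨fun n => ⌊Real.log μ / Real.log (c (φ n))⌋₊, fun _ => 0, hk, ?_⟩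
    -- `k_n log c_{φ n} = log (c_{φ n}^{k_n}) → log μ`
    have hklog : Tendsto (fun n => (⌊Real.log μ / Real.log (c (φ n))⌋₊ : ℝ) * Real.log (c (φ n))) atTop
        (𝓝 (Real.log μ)) := by
      have h := (Real.continuousAt_log hμ0.ne').tendsto.comp hk
      refine h.congr fun n => ?_
      rw [Function.comp_apply, Real.log_pow]
    have e : β * Real.log μ = Real.log μ * β := mul_comm _ _
    rw [e]
    refine (hklog.mul hβ).congr fun n => ?_
    simp only [Function.comp_apply, Int.cast_zero, mul_zero, sub_zero]
    rw [mul_assoc, mul_comm (Real.log (c (φ n))) (r (φ n)), hrθ]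
  · -- (B2) `|r_n| → ∞`: tune with the speeds `r_n / 2`
    have hrlim : Tendsto (fun n => |r n|) atTop atTop := by
      refine tendsto_atTop.2 fun R => ?_
      have h1 : ¬ ∃ᶠ n in atTop, |r n| ≤ R := fun h => hb ⟨R, h⟩
      exact (not_frequently.1 h1).mono fun n hn => (not_le.1 hn).le
    refine ⟨id, 0, strictMono_id, fun μ hμ => ?_⟩
    have hα : Tendsto (fun n => |r n / 2|) atTop atTop := by
      simp_rw [abs_div, abs_two]
      exact hrlim.atTop_div_const two_pos
    have hαc : Tendsto (fun n => r n / 2 * Real.log (c n)) atTop (𝓝 0) := by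
      have h := hθ.div_const 2
      rw [zero_div] at h
      refine h.congr fun n => ?_
      rw [div_mul_eq_mul_div, hrθ]
    obtain ⟨k, m, hk, hkm⟩ := PineauVicol2026.exists_tuned_exponents hc hlim hα hαc hμ
    refine ⟨k, m, hk, ?_⟩
    rw [zero_mul]
    refine hkm.congr fun n => ?_
    rw [id, Real.log_pow, ← hrθ n]
    ring

/-! ### Step D: the registered statement -/

/-- **Tool stub F3 `stub_angleTuning` — tuned exponents for ARBITRARY angles.** For factors `1 < c_n → 1` and any
real angles `θ_n` there are a subsequence `φ` and a rate `β` such that every `μ ≥ 1` is the limit of powers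
`c_{φ n}^{K_n}` whose accumulated angles `K_n θ_{φ n}` tend to `β log μ` modulo `2π`. (Re-tune the angles to `0`
by `exists_retune_angles`: `c'_n = c_n^{m_n} → 1`, `θ'_n = m_n θ_n − 2π j_n → 0`; apply `exists_rate_tuning` to
`(c', θ')`; then `K_n = m_{φ n} k_n` and `M_n = j_{φ n} k_n + m'_n`, since `c^{mk} = (c^m)^k` and
`K_n θ_{φ n} − 2π M_n = k_n θ'_{φ n} − 2π m'_n`.) -/
theorem stub_angleTuning :
    ∀ (c θ : ℕ → ℝ), (∀ n, 1 < c n) → Filter.Tendsto c Filter.atTop (nhds 1) →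
      ∃ (φ : ℕ → ℕ) (β : ℝ), StrictMono φ ∧ ∀ μ : ℝ, 1 ≤ μ →
        ∃ (k : ℕ → ℕ) (m : ℕ → ℤ), Filter.Tendsto (fun n => c (φ n) ^ k n) Filter.atTop (nhds μ) ∧
          Filter.Tendsto (fun n => (k n : ℝ) * θ (φ n) - 2 * Real.pi * (m n : ℝ)) Filter.atTop
            (nhds (β * Real.log μ)) := by
  intro c θ hc hlim
  obtain ⟨m, j, hm1, hcm, hmj⟩ := exists_retune_angles hc hlim θ
  have hc' : ∀ n, 1 < c n ^ m n := fun n => one_lt_pow₀ (hc n) (Nat.one_le_iff_ne_zero.1 (hm1 n))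
  obtain ⟨φ, β, hφ, H⟩ := exists_rate_tuning hc' hcm hmj
  refine ⟨φ, β, hφ, fun μ hμ => ?_⟩
  obtain ⟨k, m', hk, hkm⟩ := H μ hμ
  refine ⟨fun n => m (φ n) * k n, fun n => j (φ n) * k n + m' n, ?_, ?_⟩
  · refine hk.congr fun n => ?_
    simp only
    rw [pow_mul]
  · refine hkm.congr fun n => ?_
    push_cast
    ring

end Summit.NavierStokesRegularity.NavierStokesRegularity.Theorems.CorkscrewProfile.Birth

end
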